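import Summits.QuantumFields.YangMills.Theorems.SwapVirialDeficitGnomonicJetLine
import Summits.QuantumFields.YangMills.Theorems.SwapVirialDeficitBlowUpGnomonicDeficitDefs
import Summits.QuantumFields.YangMills.Theorems.SwapVirialDeficitBlowUpLetterPaths
import HarnessLib

/-!
# THE σ-GLUED DEFICIT IS `C^∞` JOINTLY IN THE GNOMONIC COORDINATES — `contDiff_gnoDeficit` (and a letter-generic smoothness lemma for the ring chart)
# (free-hands support of ⟨stmt-QuantumFields-24197⟩ `SwapVirialDeficit.SwapGluedStiffness`)

LEAD g97's steep-window Morse–Bott plan (W3: fibre/base split, fibre Hessian; w2 g58's socket `QuantitativeLaplaceFibrePackage`: `G ∈ C³(X × V)` with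
Fréchet-norm bounds) needs the deficit as a SMOOTH FUNCTION OF ALL GNOMONIC COORDINATES jointly, not only along one-parameter paths (✓`contDiff_chartDeficit_blowUpPoint`
is `C^n` in the blow-up parameter `t` at a fixed point).  This file:
* §1 (generic, any real normed space `X` of parameters) `contDiff_letter`, `contDiff_ringConfig_fst`, `contDiff_glue_ringConfig`, `contDiff_ringConfig_snd_fst`,
  `contDiff_ringConfig_snd_snd`, ★★ `contDiff_quatHistory_of_letters`, ★★★ `contDiff_chartDeficit_of_letters` — if the leader letters `x ↦ su2Quat (C x μ)` and the
  follower letters `x ↦ su2Quat (U x i)` are `C^n` on `X`, so is `x ↦ chartDeficit L z χ (C x, U x)` (words of ≤ 3 letters, ✓`contDiff_qDeficit`,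
  ✓`swapRingDeficit_eq_qDeficit`) — the `C^n` twin of ✓`jet4_fixHistory` ∕ ✓`speed_fixHistory`;
* §2 the gnomonic chart: `contDiff_radialUnit_gnoLetter` (`v ↦ ν(±(1,v))`, ✓`contDiffAt_radialUnit` ∘ ✓`contDiff_gnoLetter`), `contDiff_leader_gnomonic`,
  `contDiff_follower_gnomonic`, ★★★ `contDiff_gnoDeficit` — for hub `a ≠ 0` and signs `ε`, `η ↦ gnoDeficit z χ a ε η` is `C^n` on `GnoCoord L` for every `n`.
With ✓`taylor_four_gnoDeficit_line` (K7b: directional derivatives of orders ≤ 4 bounded by `poly(L)·S(ξ)ᵏ` at every point in every direction) this is the regularity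
input of the bulk fibre package; the polarisation into Fréchet-norm bounds is left to the W3 split (which fixes the norm on the fibre).

HONEST LABEL: regularity bookkeeping; no estimate on the ring's Gibbs state; nothing about ⟨24197⟩ (window-uniform, OPEN), (LW), (M), W3∕W5–W9 or any rung is proved;
⟨24194⟩ ∕ ⟨24196⟩ ∕ ⟨24497⟩ OPEN; item of record ⟨24085⟩ SubOctaveBounded aside ∕ untouched; the Yang–Mills mass gap is NOT proved; no summit is proved by a line.
THEOREMS ONLY (0 `def`, 0 `sorry`), standard axioms, no local instances.  Seat ym-line-fcl-p3 g47 (cell ym-idea-1, free hands), `--supports stmt-QuantumFields-24197`.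
References: [cite: Luscher1983, §2]; [folklore].
-/

set_option autoImplicit false
set_option synthInstance.maxSize 1024

noncomputable section

open Quaternion
open scoped Quaternion BigOperators ContDiff
open Literature.MathematicalPhysics.QuantumLattice
open Literature.MathematicalPhysics.QuantumFieldTheory hiding SU2
open Literature.Analysis.Calculus (radialUnit radialUnit_def norm_radialUnit)
open Summit.QuantumFields.YangMills.Theorems.FemtoTransferGap
open Summit.QuantumFields.YangMills.Theorems.FemtoTransferGap.TT
open Summit.QuantumFields.YangMills.Theorems.SwapTwistDeficit.ToronLog (axisPoint)
open Summit.QuantumFields.YangMills.Theorems.SwapVirialDeficit.ZeroModeSigma (su2Quat_quatToSU2_eq_radialUnit slaveP norm_axisUnit dil3 dil3_apply)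
open Summit.QuantumFields.YangMills.Theorems.SwapVirialDeficit.BlowUp (leaderTuple dil3_one' dilateIm_one_apply qDeficit swapRingDeficit_eq_qDeficit contDiff_qDeficit
  contDiffAt_radialUnit)
open Summit.QuantumFields.YangMills.Theorems.SwapVirialDeficit.BlowUpRing

namespace Summit.QuantumFields.YangMills.Theorems.SwapVirialDeficit.Gnomonic

variable {L : ℕ} [NeZero L]

/-! ## §1 Generic: smooth letters give a smooth history and a smooth deficit -/

section Generic

variable {X : Type*} [NormedAddCommGroup X] [NormedSpace ℝ X] {n : ℕ∞} {C : X → Fin 4 → SU2} {U : X → Fol L → SU2}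

omit [NeZero L] in
/-- The letter of a slice-`0` link is `C^n` in the parameters. [folklore] -/
theorem contDiff_letter (hC : ∀ μ, ContDiff ℝ n fun x => su2Quat (C x μ)) (i : OffIdx L) :
    ContDiff ℝ n fun x => su2Quat (letter (fun μ => C x (Fin.castSucc μ)) i) := by
  by_cases h : i.1.1 i.1.2 = -1
  · simp only [letter, h, if_true]; exact hC _
  · simp only [letter, h, if_false, su2Quat_one]; exact contDiff_const

/-- A slice-`0` link is `C^n` in the parameters. [folklore] -/
theorem contDiff_ringConfig_fst (χ : Site 3 L → SU2) (hC : ∀ μ, ContDiff ℝ n fun x => su2Quat (C x μ)) (hU : ∀ i, ContDiff ℝ n fun x => su2Quat (U x i))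
    (i : OffIdx L) : ContDiff ℝ n fun x => su2Quat ((ringConfig χ (C x, U x)).1 i) := by
  by_cases h : isLead i = true
  · simp only [ringConfig_fst_of_isLead χ _ h]; exact hC (Fin.castSucc i.1.2)
  · have e : ∀ x, su2Quat ((ringConfig χ (C x, U x)).1 i) = su2Quat (letter (fun μ => C x (Fin.castSucc μ)) i) * su2Quat (U x (Sum.inl ⟨i, h⟩)) := by
      intro x; rw [← su2Quat_mul]; exact congrArg su2Quat (ringConfig_fst_of_not_isLead χ (C x, U x) ⟨i, h⟩)
    simp only [e]
    exact (contDiff_letter hC i).mul (hU (Sum.inl ⟨i, h⟩))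

/-- A glued slice-`0` link is `C^n` in the parameters. [folklore] -/
theorem contDiff_glue_ringConfig (χ : Site 3 L → SU2) (hC : ∀ μ, ContDiff ℝ n fun x => su2Quat (C x μ)) (hU : ∀ i, ContDiff ℝ n fun x => su2Quat (U x i))
    (e : Edge 3 L) : ContDiff ℝ n fun x => su2Quat (glue (ringConfig χ (C x, U x)).1 e) := by
  by_cases h : treeEdge e = true
  · simp only [su2Quat_glue, h, dif_pos]; exact contDiff_const
  · simp only [su2Quat_glue, h]
    exact contDiff_ringConfig_fst χ hC hU ⟨e, h⟩

/-- A slice-`j` link (`j ≥ 1`) is `C^n` in the parameters. [folklore] -/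
theorem contDiff_ringConfig_snd_fst (χ : Site 3 L → SU2) (hC : ∀ μ, ContDiff ℝ n fun x => su2Quat (C x μ)) (hU : ∀ i, ContDiff ℝ n fun x => su2Quat (U x i))
    (j : Fin (2 * L - 1)) (e : Edge 3 L) : ContDiff ℝ n fun x => su2Quat ((ringConfig χ (C x, U x)).2.1 j e) := by
  have e' : ∀ x, su2Quat ((ringConfig χ (C x, U x)).2.1 j e) = su2Quat (glue (ringConfig χ (C x, U x)).1 e) * su2Quat (U x (Sum.inr (Sum.inl (j, e)))) := by
    intro x; rw [ringConfig_snd_fst, su2Quat_mul]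
  simp only [e']
  exact (contDiff_glue_ringConfig χ hC hU e).mul (hU (Sum.inr (Sum.inl (j, e))))

/-- A seam-site quaternion is `C^n` in the parameters. [folklore] -/
theorem contDiff_ringConfig_snd_snd (χ : Site 3 L → SU2) (hC : ∀ μ, ContDiff ℝ n fun x => su2Quat (C x μ)) (hU : ∀ i, ContDiff ℝ n fun x => su2Quat (U x i))
    (s : Site 3 L) : ContDiff ℝ n fun x => su2Quat ((ringConfig χ (C x, U x)).2.2 s) := by
  by_cases h : s = 0
  · subst h
    simp only [ringConfig_snd_snd_zero]
    exact hC (Fin.last 3)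
  · have e : ∀ x, su2Quat ((ringConfig χ (C x, U x)).2.2 s) = su2Quat (χ s) * su2Quat (C x (Fin.last 3)) * su2Quat (U x (Sum.inr (Sum.inr ⟨s, h⟩))) := by
      intro x; rw [← su2Quat_mul, ← su2Quat_mul]; exact congrArg su2Quat (ringConfig_snd_snd_of_ne χ (C x, U x) ⟨s, h⟩)
    simp only [e]
    exact (contDiff_const.mul (hC (Fin.last 3))).mul (hU (Sum.inr (Sum.inr ⟨s, h⟩)))

/-- ★★ **SMOOTH LETTERS GIVE A SMOOTH QUATERNIONIC HISTORY**: the whole history `(links, seam field)` of `fixHistory (ringConfig χ (C x, U x))`, read through `su2Quat`,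
is `C^n` in the parameters `x`. [cite: Luscher1983, §2] -/
theorem contDiff_quatHistory_of_letters (χ : Site 3 L → SU2) (hC : ∀ μ, ContDiff ℝ n fun x => su2Quat (C x μ)) (hU : ∀ i, ContDiff ℝ n fun x => su2Quat (U x i)) :
    ContDiff ℝ n (fun x : X =>
      ((fun i e => su2Quat ((fixHistory (ringConfig χ (C x, U x))).1 i e), fun s => su2Quat ((fixHistory (ringConfig χ (C x, U x))).2 s)) :
        (Fin (2 * L - 1 + 1) → Edge 3 L → ℍ) × (Site 3 L → ℍ))) := by
  refine ContDiff.prodMk ?_ ?_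
  · refine contDiff_pi.2 fun i => contDiff_pi.2 fun e => ?_
    refine Fin.cases ?_ (fun j => ?_) i
    · simp only [fixHistory, Fin.cons_zero]
      exact contDiff_glue_ringConfig χ hC hU e
    · simp only [fixHistory, Fin.cons_succ]
      exact contDiff_ringConfig_snd_fst χ hC hU j e
  · exact contDiff_pi.2 fun s => contDiff_ringConfig_snd_snd χ hC hU s

/-- ★★★ **SMOOTH LETTERS GIVE A SMOOTH DEFICIT**: if `x ↦ su2Quat (C x μ)` and `x ↦ su2Quat (U x i)` are `C^n` on a real normed space `X`, then
`x ↦ chartDeficit L z χ (C x, U x)` is `C^n` (✓`contDiff_qDeficit` ∘ `contDiff_quatHistory_of_letters`, ✓`swapRingDeficit_eq_qDeficit`). [cite: Luscher1983, §2] -/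
theorem contDiff_chartDeficit_of_letters (z : Fin 3 → Bool) (χ : Site 3 L → SU2) (hC : ∀ μ, ContDiff ℝ n fun x => su2Quat (C x μ))
    (hU : ∀ i, ContDiff ℝ n fun x => su2Quat (U x i)) : ContDiff ℝ n fun x : X => chartDeficit L z χ (C x, U x) := by
  have e : (fun x : X => chartDeficit L z χ (C x, U x)) = fun x => qDeficit z
      ((fun i e => su2Quat ((fixHistory (ringConfig χ (C x, U x))).1 i e), fun s => su2Quat ((fixHistory (ringConfig χ (C x, U x))).2 s)) :
        (Fin (2 * L - 1 + 1) → Edge 3 L → ℍ) × (Site 3 L → ℍ)) :=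
    funext fun x => swapRingDeficit_eq_qDeficit z _
  rw [e]
  exact (contDiff_qDeficit (L := L) (n := n) z).comp (contDiff_quatHistory_of_letters χ hC hU)

end Generic

/-! ## §2 The gnomonic chart: the deficit is `C^n` jointly in all gnomonic coordinates -/

section Gnomonic

variable {n : ℕ∞}

omit [NeZero L] in
/-- `v ↦ ν(±(1, v)) = su2Quat (quatToSU2 (gnoLetter ε v))` is `C^n` on `ℝ³`. [folklore] -/
theorem contDiff_radialUnit_gnoLetter (ε : Bool) : ContDiff ℝ n fun v : Fin 3 → ℝ => su2Quat (quatToSU2 (gnoLetter ε v)) := by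
  have e : (fun v : Fin 3 → ℝ => su2Quat (quatToSU2 (gnoLetter ε v))) = fun v => radialUnit (gnoLetter ε v) :=
    funext fun v => su2Quat_quatToSU2_eq_radialUnit (gnoLetter_ne_zero ε v)
  rw [e]
  exact contDiff_iff_contDiffAt.2 fun v => (contDiffAt_radialUnit (gnoLetter_ne_zero ε v)).comp v (contDiff_gnoLetter ε).contDiffAt

/-- ★ **Every leader of `blowUpPoint 1 (gnomonicPoint a ε η)` is `C^n` in `η`** (`a ≠ 0`). [folklore] -/
theorem contDiff_leader_gnomonic {a : ℍ} (ha : a ≠ 0) (ε : GnoSign L) (μ : Fin 4) :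
    ContDiff ℝ n fun η : GnoCoord L => su2Quat ((blowUpPoint (L := L) 1 (gnomonicPoint a ε η)).1 μ) := by
  have hx : ContDiff ℝ n fun η : GnoCoord L => su2Quat (quatToSU2 (gnoLetter ε.1.1 η.1.1)) :=
    (contDiff_radialUnit_gnoLetter ε.1.1).comp (contDiff_fst.comp contDiff_fst)
  have hy : ContDiff ℝ n fun η : GnoCoord L => su2Quat (quatToSU2 (gnoLetter ε.1.2 η.1.2)) :=
    (contDiff_radialUnit_gnoLetter ε.1.2).comp (contDiff_snd.comp contDiff_fst)
  have hz : ContDiff ℝ n fun η : GnoCoord L => su2Quat (quatToSU2 (gnoLetter ε.2.1 η.2.1)) :=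
    (contDiff_radialUnit_gnoLetter ε.2.1).comp (contDiff_fst.comp contDiff_snd)
  match μ with
  | ⟨0, _⟩ =>
    have e : ∀ η : GnoCoord L, su2Quat ((blowUpPoint (L := L) 1 (gnomonicPoint a ε η)).1 ⟨0, by omega⟩) = su2Quat (quatToSU2 (gnoLetter ε.1.1 η.1.1)) :=
      fun η => by
        show su2Quat (leaderTuple a (dil3 1 (gnomonicPoint a ε η).2.1) 0) = _
        rw [(BlowUp.leaderTuple_apply _ _).1, dil3_one']; rfl
    simp only [e]; exact hx
  | ⟨1, _⟩ =>
    have e : ∀ η : GnoCoord L, su2Quat ((blowUpPoint (L := L) 1 (gnomonicPoint a ε η)).1 ⟨1, by omega⟩) =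
        star (radialUnit (axisPoint a)) * su2Quat (quatToSU2 (gnoLetter ε.1.1 η.1.1)) * radialUnit (axisPoint a) * su2Quat (quatToSU2 (gnoLetter ε.2.1 η.2.1)) :=
      fun η => by
        show su2Quat (leaderTuple a (dil3 1 (gnomonicPoint a ε η).2.1) 1) = _
        rw [(BlowUp.leaderTuple_apply _ _).2.1, dil3_one']
        exact su2Quat_quatToSU2_slaveP_mul (norm_axisUnit ha) (gnoLetter_ne_zero _ _) (gnoLetter_ne_zero _ _)
    simp only [e]
    exact ((contDiff_const.mul hx).mul contDiff_const).mul hz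
  | ⟨2, _⟩ =>
    have e : ∀ η : GnoCoord L, su2Quat ((blowUpPoint (L := L) 1 (gnomonicPoint a ε η)).1 ⟨2, by omega⟩) = su2Quat (quatToSU2 (gnoLetter ε.1.2 η.1.2)) :=
      fun η => by
        show su2Quat (leaderTuple a (dil3 1 (gnomonicPoint a ε η).2.1) 2) = _
        rw [(BlowUp.leaderTuple_apply _ _).2.2.1, dil3_one']; rfl
    simp only [e]; exact hy
  | ⟨3, _⟩ =>
    have e : ∀ η : GnoCoord L, su2Quat ((blowUpPoint (L := L) 1 (gnomonicPoint a ε η)).1 ⟨3, by omega⟩) = radialUnit (axisPoint a) := fun η => by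
      show su2Quat (leaderTuple a (dil3 1 (gnomonicPoint a ε η).2.1) 3) = _
      rw [(BlowUp.leaderTuple_apply _ _).2.2.2]; exact su2Quat_quatToSU2_axisUnit ha
    simp only [e]; exact contDiff_const

/-- ★ **Every follower of `blowUpPoint 1 (gnomonicPoint a ε η)` is `C^n` in `η`.** [folklore] -/
theorem contDiff_follower_gnomonic (a : ℍ) (ε : GnoSign L) (i : Fol L) :
    ContDiff ℝ n fun η : GnoCoord L => su2Quat ((blowUpPoint (L := L) 1 (gnomonicPoint a ε η)).2 i) := by
  have e : ∀ η : GnoCoord L, su2Quat ((blowUpPoint (L := L) 1 (gnomonicPoint a ε η)).2 i) = su2Quat (quatToSU2 (gnoLetter (ε.2.2 i) (η.2.2 i))) := fun η => by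
    show su2Quat (quatToSU2 (ZeroModeSigma.dilateIm 1 (gnoLetter (ε.2.2 i) (η.2.2 i)))) = _
    rw [dilateIm_one_apply]
  simp only [e]
  have hπ : ContDiff ℝ n fun η : GnoCoord L => η.2.2 i := (contDiff_apply ℝ (Fin 3 → ℝ) i).comp (contDiff_snd.comp contDiff_snd)
  exact (contDiff_radialUnit_gnoLetter (ε.2.2 i)).comp hπ

/-- ★★★ **THE σ-GLUED DEFICIT IS `C^n` JOINTLY IN ALL GNOMONIC COORDINATES**: for hub `a ≠ 0`, signs `ε`, sector `z`, character `χ` and every `n`,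
`η ↦ gnoDeficit z χ a ε η` is `C^n` on `GnoCoord L`. [cite: Luscher1983, §2] -/
theorem contDiff_gnoDeficit (z : Fin 3 → Bool) (χ : Site 3 L → SU2) {a : ℍ} (ha : a ≠ 0) (ε : GnoSign L) :
    ContDiff ℝ n fun η : GnoCoord L => gnoDeficit z χ a ε η :=
  contDiff_chartDeficit_of_letters (C := fun η : GnoCoord L => (blowUpPoint (L := L) 1 (gnomonicPoint a ε η)).1)
    (U := fun η : GnoCoord L => (blowUpPoint (L := L) 1 (gnomonicPoint a ε η)).2) z χ (contDiff_leader_gnomonic ha ε) (contDiff_follower_gnomonic a ε)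

end Gnomonic

end Summit.QuantumFields.YangMills.Theorems.SwapVirialDeficit.Gnomonic

end
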